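import Mathlib
import Summits.Ventures.HodgeRepro.Tier4.Common.CongruenceAdeles
import Summits.Ventures.HodgeRepro.Tier4.Common.CompactOpenLevel
import Summits.Ventures.HodgeRepro.Tier4.Line4.FinitePlacePositivity
import Summits.Ventures.HodgeRepro.Tier4.Line4.FinitePartClosed
import Summits.Ventures.HodgeRepro.Tier4.Line4.LevelIndicatorAverage

/-!
# Tier4/Line4/LevelIndexBound — the index bound `μ(K(pⁿ) γ₀ K(pⁿ)) ≤ M₁ · μ(K(pⁿ))`, uniformly in `n`

Blind re-derivation cell `pub-hodge-repro`, Tier 4 «prove the step» (README §9–§10), seat t4-L4-p2 (prover, LINE L4,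
gen 4; cut C-L4-INDEXBOUND, plan-4 g5 S15328, statement S15342).  Tree path
`lean/Summits/Ventures/HodgeRepro/Tier4/Line4/LevelIndexBound.lean`.  No `def`; no literature.

THE STATEMENT.  For a Haar measure `μ₀` on `G(𝔸_f)` (= `finitePart W`), a prime `p`, and `γ₀ ∈ G(𝔸_f)` whose entries and
inverse entries are `v`-integral at the places `v` above `p` (the raw valuation hypothesis `hγ₀`), the level double cosets
`K(pⁿ) γ₀ K(pⁿ)` have measure at most `M₁ · μ₀(K(pⁿ))` with ONE `M₁` for all `n` — the clause `TailFamily'.l1` of the natural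
witness `ffinLevel` (the normalised indicator of the double coset), `N`-independent.

THE PROOF (no local index computation).
* `isCongr_conj_of_isCongr_one` (matrix level): if `X ≡ 1 (mod pⁿ)` and `B⁻¹ X B ≡ 1 (mod 1)` (integral with integral
  inverse), with `B`, `B⁻¹` integral at the places above `p`, then `B⁻¹ X B ≡ 1 (mod pⁿ)`: at `v ∤ p` the modulus is trivial
  (`|pⁿ|_v = 1`); at `v ∣ p` the entries of `B⁻¹ X B − 1 = B⁻¹ (X − 1) B` are sums of products `(B⁻¹)_{ia} (X − 1)_{ab} B_{bj}`,
  each of `v`-size `≤ 1 · |pⁿ|_v · 1` (ultrametric).  Hence `mem_levelK_conj`: `x ∈ K(pⁿ)`, `γ₀⁻¹ x γ₀ ∈ K(1)` ⇒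
  `γ₀⁻¹ x γ₀ ∈ K(pⁿ)`.
* The cover: `K′ := K(1) ∩ γ₀ K(1) γ₀⁻¹` is open in the compact `K(1)`, so finitely many left translates `κ K′`, `κ ∈ t`,
  cover `K(1)` — `t` does not depend on `n`.  For `n` and `κ ∈ t` with `K(pⁿ) ∩ κ K′ ≠ ∅`, pick `x_κ` in it; then
  `K(pⁿ) ∩ κ K′ ⊆ x_κ (K(pⁿ) ∩ K′)` and `(K(pⁿ) ∩ K′) γ₀ ⊆ γ₀ K(pⁿ)` (the conjugation lemma), so
  `K(pⁿ) γ₀ K(pⁿ) ⊆ ⋃_{κ ∈ t} x_κ γ₀ K(pⁿ)` — at most `#t` left translates of `K(pⁿ)`, each of measure `μ₀(K(pⁿ))`.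
* `levelDoubleCoset_measure_le`: `μ₀(K(pⁿ) γ₀ K(pⁿ)) ≤ #t · μ₀(K(pⁿ))`, in `ℝ≥0∞` and in `ℝ` (both sides finite: `K(pⁿ)`
  compact); `levelDoubleCoset_measure_le_of_natSize_lt_one` = the same with the hypothesis in the posted form
  `natSize k v p < 1 → …` (`natSize_lt_one_iff_mem`: `|p|_v < 1 ↔ (p : 𝓞 k) ∈ v.asIdeal`).

RECORD (lead (R-35) S15347, plan-4 g5 S15355 (1)): this general bound, under the raw per-place hypothesis at the places
above `p`, is the index bound OF RECORD (the consumer `hidx` of L1-p1's `tailFamily'_naturalMu`); the integral case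
`IsIntegralFin W γ₀ ∧ IsIntegralFin W γ₀⁻¹` everywhere (`M₁ = 1`, every level `N`) is L1-p3's distinct module
`Tier4/Line4/LevelIndexIntegral.lean` (`levelDoubleCoset_eq_of_isIntegralFin`, `measure_levelDoubleCoset_toReal_le`),
cited by name and not re-proved here.  The hypothesis is met by the CHOICE of the level prime `p` away from the finitely many
places where `γ₀` or `γ₀⁻¹` fails to be integral (the existence of such a `p` is typed beside this module).

Nothing here says anything about the status of the Hodge conjecture for CM abelian varieties, which is NOT proved
(HC_CM is NOT proved by anyone in this repository).
-/

set_option autoImplicit false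

noncomputable section

namespace Summit.Ventures.HodgeRepro.Tier4.Line4

open Summit.Ventures.HodgeRepro.Tier4.Common Summit.Ventures.HodgeRepro.Tier4.Line1 MeasureTheory NumberField
  IsDedekindDomain Topology

open scoped Pointwise ENNReal

/-! ## 1. Valuations: `|pⁿ|_v = 1` off `p`, and the conjugation lemma -/

section Valuation

variable {k : Type} [Field k] [NumberField k]

/-- `|p|_v = 1` when `v ∤ p`. -/
theorem natSize_eq_one_of_not_mem (v : HeightOneSpectrum (𝓞 k)) (p : ℕ) (hp : ¬ ((p : 𝓞 k) ∈ v.asIdeal)) :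
    natSize k v p = 1 := by
  unfold natSize
  rw [HeightOneSpectrum.valuedAdicCompletion_eq_valuation' v (p : k)]
  have h1 : v.valuation k ((p : 𝓞 k) : k) ≤ 1 := HeightOneSpectrum.valuation_le_one v (p : 𝓞 k)
  have h2 : ¬ v.valuation k ((p : 𝓞 k) : k) < 1 := by
    rw [HeightOneSpectrum.valuation_lt_one_iff_mem]
    exact hp
  have : ((p : 𝓞 k) : k) = (p : k) := by simp
  rw [this] at h1 h2
  exact le_antisymm h1 (not_lt.mp h2)

/-- `|p|_v < 1 ↔ v ∣ p`: the bus form of the integrality hypothesis (`natSize k v p < 1 → …`, S15342) and its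
ideal-membership form (`(p : 𝓞 k) ∈ v.asIdeal → …`, used below) are the same hypothesis. -/
theorem natSize_lt_one_iff_mem (v : HeightOneSpectrum (𝓞 k)) (p : ℕ) :
    natSize k v p < 1 ↔ (p : 𝓞 k) ∈ v.asIdeal := by
  unfold natSize
  rw [HeightOneSpectrum.valuedAdicCompletion_eq_valuation' v (p : k)]
  have : ((p : 𝓞 k) : k) = (p : k) := by simp
  rw [← this]
  exact HeightOneSpectrum.valuation_lt_one_iff_mem v (p : 𝓞 k)

/-- `|pⁿ|_v = 1` when `v ∤ p`. -/
theorem natSize_pow_eq_one_of_not_mem (v : HeightOneSpectrum (𝓞 k)) (p n : ℕ) (hp : ¬ ((p : 𝓞 k) ∈ v.asIdeal)) :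
    natSize k v (p ^ n) = 1 := by
  rw [natSize_pow, natSize_eq_one_of_not_mem v p hp, one_pow]

/-- `|1|_v = 1`. -/
theorem natSize_one (v : HeightOneSpectrum (𝓞 k)) : natSize k v 1 = 1 := by
  unfold natSize
  simp

/-- The `v`-component of a finite sum of finite adeles. -/
theorem finiteAdele_sum_apply {ι : Type} (s : Finset ι) (f : ι → FiniteAdeleRing (𝓞 k) k)
    (v : HeightOneSpectrum (𝓞 k)) : (∑ i ∈ s, f i) v = ∑ i ∈ s, (f i) v := by
  classical
  induction s using Finset.induction_on with
  | empty => rfl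
  | insert a s ha ih => rw [Finset.sum_insert ha, Finset.sum_insert ha, ← ih]; rfl

/-- **The conjugation lemma at the matrix level**: `X ≡ 1 (mod pⁿ)`, `B⁻¹ X B ≡ 1 (mod 1)`, and `B`, `Binv` integral at the
places above `p` (with `Binv * B = 1`) give `Binv * X * B ≡ 1 (mod pⁿ)`. -/
theorem isCongr_conj_of_isCongr_one (p n : ℕ) {B Binv X : M4 k} (hBB : Binv * B = 1)
    (hB : ∀ v : HeightOneSpectrum (𝓞 k), (p : 𝓞 k) ∈ v.asIdeal → ∀ i j, Valued.v (finPart k (B i j) v) ≤ 1)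
    (hBinv : ∀ v : HeightOneSpectrum (𝓞 k), (p : 𝓞 k) ∈ v.asIdeal → ∀ i j, Valued.v (finPart k (Binv i j) v) ≤ 1)
    (hX : IsCongr k (p ^ n) X) (hY1 : IsCongr k 1 (Binv * X * B)) : IsCongr k (p ^ n) (Binv * X * B) := by
  intro i j
  refine ⟨(hY1 i j).1, ?_⟩
  intro v
  by_cases hv : (p : 𝓞 k) ∈ v.asIdeal
  · -- at a place above `p`: the product expansion
    have hid : Binv * X * B - 1 = Binv * (X - 1) * B := by
      rw [Matrix.mul_sub, Matrix.sub_mul, Matrix.mul_one, hBB]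
    rw [hid]
    have hentry : (Binv * (X - 1) * B) i j = ∑ b : Fin 4, ∑ a : Fin 4, Binv i a * (X - 1) a b * B b j := by
      simp only [Matrix.mul_apply, Finset.sum_mul]
    rw [hentry, map_sum, finiteAdele_sum_apply]
    refine Valuation.map_sum_le Valued.v fun b _ => ?_
    rw [map_sum, finiteAdele_sum_apply]
    refine Valuation.map_sum_le Valued.v fun a _ => ?_
    rw [map_mul, map_mul]
    show Valued.v (finPart k (Binv i a) v * finPart k ((X - 1) a b) v * finPart k (B b j) v) ≤ _
    rw [Valuation.map_mul, Valuation.map_mul]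
    have h1 := hBinv v hv i a
    have h2 := (hX a b).2 v
    have h3 := hB v hv b j
    calc Valued.v (finPart k (Binv i a) v) * Valued.v (finPart k ((X - 1) a b) v) * Valued.v (finPart k (B b j) v)
        ≤ 1 * natSize k v (p ^ n) * 1 := mul_le_mul' (mul_le_mul' h1 h2) h3
      _ = natSize k v (p ^ n) := by rw [one_mul, mul_one]
  · -- off `p`: the modulus is trivial, integrality suffices
    rw [natSize_pow_eq_one_of_not_mem v p n hv]
    have := (hY1 i j).2 v
    rwa [natSize_one] at this

end Valuation

/-! ## 2. The conjugation lemma on `G(𝔸)` -/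

section Group

variable {k : Type} [Field k] [NumberField k] (W : PlaneData k)

/-- **`γ₀⁻¹ K(pⁿ) γ₀ ∩ K(1) ⊆ K(pⁿ)`** for `γ₀` integral (with integral inverse) at the places above `p`. -/
theorem mem_levelK_conj (p n : ℕ) {γ₀ x : GA W}
    (hγ₀ : ∀ v : HeightOneSpectrum (𝓞 k), (p : 𝓞 k) ∈ v.asIdeal → ∀ i j, Valued.v (finPart k (GA.mat W γ₀ i j) v) ≤ 1)
    (hγ₀' : ∀ v : HeightOneSpectrum (𝓞 k), (p : 𝓞 k) ∈ v.asIdeal → ∀ i j,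
      Valued.v (finPart k (GA.mat W γ₀⁻¹ i j) v) ≤ 1)
    (hx : x ∈ levelK W (p ^ n)) (h1 : γ₀⁻¹ * x * γ₀ ∈ levelK W 1) : γ₀⁻¹ * x * γ₀ ∈ levelK W (p ^ n) := by
  rw [mem_levelK] at hx h1 ⊢
  refine ⟨?_, ?_⟩
  · have h := isCongr_conj_of_isCongr_one p n (B := GA.mat W γ₀) (Binv := GA.mat W γ₀⁻¹) (X := GA.mat W x)
      (GA.mat_inv_mul W γ₀) hγ₀ hγ₀' hx.1 h1.1
    exact h
  · have hinv : (γ₀⁻¹ * x * γ₀)⁻¹ = γ₀⁻¹ * x⁻¹ * γ₀ := by group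
    rw [hinv] at h1 ⊢
    have h := isCongr_conj_of_isCongr_one p n (B := GA.mat W γ₀) (Binv := GA.mat W γ₀⁻¹) (X := GA.mat W x⁻¹)
      (GA.mat_inv_mul W γ₀) hγ₀ hγ₀' hx.2 h1.2
    exact h

end Group

/-! ## 3. The cover and the measure bound -/

section Measure

variable {k : Type} [Field k] [NumberField k] (W : PlaneData k) [MeasurableSpace (GA W)] [BorelSpace (GA W)]

omit [MeasurableSpace (GA W)] [BorelSpace (GA W)] in
/-- The level subgroup, as a subset of `G(𝔸_f)`, is compact (`N ≠ 0`). -/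
theorem isCompact_coe_mem_levelK_finitePart {N : ℕ} (hN : N ≠ 0) :
    IsCompact {y : finitePart W | (y : GA W) ∈ levelK W N} :=
  (isClosed_finitePart W).isClosedEmbedding_subtypeVal.isCompact_preimage (isCompact_levelK W hN)

/-- **THE INDEX BOUND**: for a Haar measure on `G(𝔸_f)`, a prime `p`, and `γ₀ ∈ G(𝔸_f)` integral with integral inverse
at the places above `p`, `μ₀(K(pⁿ) γ₀ K(pⁿ)) ≤ M₁ · μ₀(K(pⁿ))` with ONE `M₁` for every `n` (`M₁` = the number of
translates of `K(1) ∩ γ₀ K(1) γ₀⁻¹` covering `K(1)`). -/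
theorem levelDoubleCoset_measure_le_ennreal (μ₀ : Measure (finitePart W)) [μ₀.IsHaarMeasure] {γ₀ : GA W}
    (hγ₀f : γ₀ ∈ finitePart W) (p : ℕ)
    (hγ₀ : ∀ v : HeightOneSpectrum (𝓞 k), (p : 𝓞 k) ∈ v.asIdeal → ∀ i j, Valued.v (finPart k (GA.mat W γ₀ i j) v) ≤ 1)
    (hγ₀' : ∀ v : HeightOneSpectrum (𝓞 k), (p : 𝓞 k) ∈ v.asIdeal → ∀ i j,
      Valued.v (finPart k (GA.mat W γ₀⁻¹ i j) v) ≤ 1) :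
    ∃ M₁ : ℕ, ∀ n : ℕ, μ₀ {y : finitePart W | (y : GA W) ∈ levelDoubleCoset W (p ^ n) γ₀} ≤
      (M₁ : ℝ≥0∞) * μ₀ {y : finitePart W | (y : GA W) ∈ levelK W (p ^ n)} := by
  classical
  set γf : finitePart W := ⟨γ₀, hγ₀f⟩ with hγf
  -- `K′ = K(1) ∩ γ₀ K(1) γ₀⁻¹`, open in `G(𝔸_f)`, a subgroup
  set K' : Set (finitePart W) :=
    {y | (y : GA W) ∈ levelK W 1 ∧ γ₀⁻¹ * (y : GA W) * γ₀ ∈ levelK W 1} with hK'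
  have hK'o : IsOpen K' := by
    refine IsOpen.inter ?_ ?_
    · exact isOpen_preimage_levelK_of_continuous W one_ne_zero continuous_subtype_val fun y => y.2
    · refine isOpen_preimage_levelK_of_continuous W one_ne_zero
        ((continuous_const.mul continuous_subtype_val).mul continuous_const) fun y => ?_
      exact Subgroup.mul_mem _ (Subgroup.mul_mem _ (Subgroup.inv_mem _ hγ₀f) y.2) hγ₀f
  have hK'1 : (1 : finitePart W) ∈ K' := by
    refine ⟨Subgroup.one_mem _, ?_⟩
    simp only [Subgroup.coe_one, mul_one, inv_mul_cancel]
    exact Subgroup.one_mem _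
  have hK'div : ∀ a ∈ K', ∀ b ∈ K', a⁻¹ * b ∈ K' := by
    intro a ha b hb
    refine ⟨?_, ?_⟩
    · rw [Subgroup.coe_mul, Subgroup.coe_inv]
      exact Subgroup.mul_mem _ (Subgroup.inv_mem _ ha.1) hb.1
    · have : γ₀⁻¹ * ((a⁻¹ * b : finitePart W) : GA W) * γ₀ =
          (γ₀⁻¹ * (a : GA W) * γ₀)⁻¹ * (γ₀⁻¹ * (b : GA W) * γ₀) := by
        rw [Subgroup.coe_mul, Subgroup.coe_inv]
        group
      rw [this]
      exact Subgroup.mul_mem _ (Subgroup.inv_mem _ ha.2) hb.2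
  -- the finite cover of the compact `K(1)` by translates of `K′`
  have hK1c : IsCompact {y : finitePart W | (y : GA W) ∈ levelK W 1} :=
    isCompact_coe_mem_levelK_finitePart W one_ne_zero
  obtain ⟨t, -, ht⟩ := hK1c.elim_nhds_subcover (fun κ : finitePart W => {y | κ⁻¹ * y ∈ K'}) fun κ _ => by
    refine (hK'o.preimage (continuous_const.mul continuous_id)).mem_nhds ?_
    show κ⁻¹ * κ ∈ K'
    rw [inv_mul_cancel]
    exact hK'1
  refine ⟨t.card, fun n => ?_⟩
  set KN : Set (finitePart W) := {y | (y : GA W) ∈ levelK W (p ^ n)} with hKN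
  have hKNmem : ∀ z : finitePart W, z ∈ KN ↔ (z : GA W) ∈ levelK W (p ^ n) := fun z => Iff.rfl
  -- the pieces
  set V : finitePart W → Set (finitePart W) := fun κ =>
    {y | ∃ x ∈ KN, κ⁻¹ * x ∈ K' ∧ (x * γf)⁻¹ * y ∈ KN} with hV
  -- each piece has measure at most `μ₀(K(pⁿ))`
  have hVle : ∀ κ, μ₀ (V κ) ≤ μ₀ KN := by
    intro κ
    by_cases hne : (V κ).Nonempty
    · obtain ⟨y₀, x₀, hx₀, hκx₀, -⟩ := hne
      have hsub : V κ ⊆ (fun h => (x₀ * γf)⁻¹ * h) ⁻¹' KN := by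
        rintro y ⟨x, hx, hκx, hy⟩
        -- `(x₀ γ₀)⁻¹ y = γ₀⁻¹ (x₀⁻¹ x) γ₀ · ((x γ₀)⁻¹ y)`
        have hz : x₀⁻¹ * x ∈ KN := by
          rw [hKNmem, Subgroup.coe_mul, Subgroup.coe_inv]
          exact Subgroup.mul_mem _ (Subgroup.inv_mem _ hx₀) hx
        have hzK' : x₀⁻¹ * x ∈ K' := by
          have := hK'div _ hκx₀ _ hκx
          rwa [mul_inv_rev, inv_inv, mul_assoc, mul_inv_cancel_left] at this
        have hconj : γ₀⁻¹ * ((x₀⁻¹ * x : finitePart W) : GA W) * γ₀ ∈ levelK W (p ^ n) :=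
          mem_levelK_conj W p n hγ₀ hγ₀' hz hzK'.2
        show ((x₀ * γf)⁻¹ * y : finitePart W) ∈ KN
        have heq : ((x₀ * γf)⁻¹ * y : finitePart W) =
            ⟨γ₀⁻¹ * ((x₀⁻¹ * x : finitePart W) : GA W) * γ₀,
              Subgroup.mul_mem _ (Subgroup.mul_mem _ (Subgroup.inv_mem _ hγ₀f) (x₀⁻¹ * x).2) hγ₀f⟩ *
            ((x * γf)⁻¹ * y) := by
          apply Subtype.ext
          simp only [Subgroup.coe_mul, Subgroup.coe_inv, hγf]
          group
        rw [heq, hKNmem, Subgroup.coe_mul]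
        exact Subgroup.mul_mem _ hconj hy
      calc μ₀ (V κ) ≤ μ₀ ((fun h => (x₀ * γf)⁻¹ * h) ⁻¹' KN) := measure_mono hsub
        _ = μ₀ KN := measure_preimage_mul μ₀ _ _
    · rw [Set.not_nonempty_iff_eq_empty.mp hne, measure_empty]
      exact zero_le
  -- the double coset is covered by the pieces
  have hcover : {y : finitePart W | (y : GA W) ∈ levelDoubleCoset W (p ^ n) γ₀} ⊆ ⋃ κ ∈ t, V κ := by
    intro y hy
    obtain ⟨_, ⟨κ₁, hκ₁, g, hg, rfl⟩, κ₂, hκ₂, hyeq⟩ := hy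
    rw [Set.mem_singleton_iff] at hg
    rw [hg] at hyeq
    have hκ₁f : κ₁ ∈ finitePart W := levelK_le_finitePart W _ hκ₁
    set x : finitePart W := ⟨κ₁, hκ₁f⟩ with hx
    have hxK1 : x ∈ {y : finitePart W | (y : GA W) ∈ levelK W 1} :=
      Line1.levelK_antitone W (one_dvd _) hκ₁
    obtain ⟨κ, hκt, hκ⟩ := Set.mem_iUnion₂.mp (ht hxK1)
    refine Set.mem_iUnion₂.mpr ⟨κ, hκt, x, hκ₁, hκ, ?_⟩
    show (((x * γf)⁻¹ * y : finitePart W) : GA W) ∈ levelK W (p ^ n)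
    have : (((x * γf)⁻¹ * y : finitePart W) : GA W) = κ₂ := by
      rw [Subgroup.coe_mul, Subgroup.coe_inv, Subgroup.coe_mul, hx, hγf]
      show (κ₁ * γ₀)⁻¹ * (y : GA W) = κ₂
      rw [← hyeq]
      group
    rw [this]
    exact hκ₂
  calc μ₀ {y : finitePart W | (y : GA W) ∈ levelDoubleCoset W (p ^ n) γ₀}
      ≤ μ₀ (⋃ κ ∈ t, V κ) := measure_mono hcover
    _ ≤ ∑ κ ∈ t, μ₀ (V κ) := measure_biUnion_finset_le t V
    _ ≤ ∑ _κ ∈ t, μ₀ KN := Finset.sum_le_sum fun κ _ => hVle κ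
    _ = (t.card : ℝ≥0∞) * μ₀ KN := by rw [Finset.sum_const, nsmul_eq_mul]

/-- **The index bound in `ℝ`** (`TailFamily'.l1` for the natural witness): `μ₀(K(pⁿ) γ₀ K(pⁿ)).toReal ≤ M₁ · μ₀(K(pⁿ)).toReal`
for every `n`, `p` prime. -/
theorem levelDoubleCoset_measure_le (μ₀ : Measure (finitePart W)) [μ₀.IsHaarMeasure] {γ₀ : GA W}
    (hγ₀f : γ₀ ∈ finitePart W) (p : ℕ) (hp : p.Prime)
    (hγ₀ : ∀ v : HeightOneSpectrum (𝓞 k), (p : 𝓞 k) ∈ v.asIdeal → ∀ i j, Valued.v (finPart k (GA.mat W γ₀ i j) v) ≤ 1)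
    (hγ₀' : ∀ v : HeightOneSpectrum (𝓞 k), (p : 𝓞 k) ∈ v.asIdeal → ∀ i j,
      Valued.v (finPart k (GA.mat W γ₀⁻¹ i j) v) ≤ 1) :
    ∃ M₁ : ℝ, 0 ≤ M₁ ∧ ∀ n : ℕ, (μ₀ {y : finitePart W | (y : GA W) ∈ levelDoubleCoset W (p ^ n) γ₀}).toReal ≤
      M₁ * (μ₀ {y : finitePart W | (y : GA W) ∈ levelK W (p ^ n)}).toReal := by
  obtain ⟨M₁, hM₁⟩ := levelDoubleCoset_measure_le_ennreal W μ₀ hγ₀f p hγ₀ hγ₀'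
  refine ⟨M₁, Nat.cast_nonneg _, fun n => ?_⟩
  have hKN : μ₀ {y : finitePart W | (y : GA W) ∈ levelK W (p ^ n)} ≠ ∞ :=
    (isCompact_coe_mem_levelK_finitePart W (pow_ne_zero n hp.ne_zero)).measure_lt_top.ne
  have h := ENNReal.toReal_mono (ENNReal.mul_ne_top (ENNReal.natCast_ne_top M₁) hKN) (hM₁ n)
  rwa [ENNReal.toReal_mul, ENNReal.toReal_natCast] at h

/-- **The index bound, in the form posted as the statement of record (S15342)**: the integrality hypothesis written with
`natSize k v p < 1` (`= |p|_v < 1`, i.e. `v ∣ p`, `natSize_lt_one_iff_mem`) and both matrices in one clause. -/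
theorem levelDoubleCoset_measure_le_of_natSize_lt_one (μ₀ : Measure (finitePart W)) [μ₀.IsHaarMeasure] {γ₀ : GA W}
    (hγ₀f : γ₀ ∈ finitePart W) (p : ℕ) (hp : p.Prime)
    (hγ₀ : ∀ v : HeightOneSpectrum (𝓞 k), natSize k v p < 1 → ∀ i j,
      Valued.v (finPart k (GA.mat W γ₀ i j) v) ≤ 1 ∧ Valued.v (finPart k (GA.mat W γ₀⁻¹ i j) v) ≤ 1) :
    ∃ M₁ : ℝ, 0 ≤ M₁ ∧ ∀ n : ℕ, (μ₀ {y : finitePart W | (y : GA W) ∈ levelDoubleCoset W (p ^ n) γ₀}).toReal ≤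
      M₁ * (μ₀ {y : finitePart W | (y : GA W) ∈ levelK W (p ^ n)}).toReal :=
  levelDoubleCoset_measure_le W μ₀ hγ₀f p hp
    (fun v hv i j => (hγ₀ v ((natSize_lt_one_iff_mem v p).mpr hv) i j).1)
    (fun v hv i j => (hγ₀ v ((natSize_lt_one_iff_mem v p).mpr hv) i j).2)

end Measure

end Summit.Ventures.HodgeRepro.Tier4.Line4

end
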